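/-
Copyright (c) 2026 the pub-hodgecm-mathlib formalisation cell (harness21).  Prover seat hodgecm-mathlib-K2E1-p10 (g0), Track B ∕ K2-LIT, h413 = `stmt-HodgeConjecture-24833`,
line `K2_E1_TraceFormulaBeta`, campaign «EIS-R7-BL-SPH-3» (Bernstein–Lapid at `N = 3`), file K1₃-L² part 1 (dealer K2E1-plan (g5) RE-KEY 2026-09-04T09:23:57Z «K1₃-L² →
K2E1-p10»): THE BOREL CONSTANT TERM OF A RIGHT SMOOTHING — `(R(η)φ)_B(g) = ∫ η(y)·φ_B(g·y) dν(y)` — and its VANISHING above `κ·H₀` when `φ_B` vanishes almost everywhere above `H₀`.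
-/
import Summits.HodgeConjecture.HodgeConjecture.Theorems.K2E1TruncatedKernelDecayU3        -- ★ K1₃ (K2E1-p02 g6): `locallyIntegrable_comp_mul_left`; brings ★ `K2E1TruncatedZeroMeanU3` §1 (the right smoothing `R(η)φ`), ★ `borelConstantTerm`
import Summits.HodgeConjecture.HodgeConjecture.Theorems.K2E1BLHeckeOperatorWeightedU2     -- ★ P3-A (K2E1-p09): `exists_borelHeight_mul_le_of_isCompact` (two-sided `H(x·y) ≍ H(x)` on compacts)
import HarnessLib

/-!
# K2·E1 — `K2E1TruncatedSmoothingConstantTermU3` (K1₃-L², part 1): `(R(η)φ)_B(g) = ∫ η(y) φ_B(gy) dν(y)`, AND `φ_B = 0` A.E. ABOVE `H₀` ⟹ `(R(η)φ)_B = 0` EVERYWHERE ABOVE `κ·H₀`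

Track B ∕ K2-LIT, crux h413 = `stmt-HodgeConjecture-24833`, route of record `HCCMUnconditional`; cell `hodgecm-mathlib`, squad K2, ENGINE E1 (campaign «EIS-R7-BL-SPH-3»).
THEOREMS ONLY (no `def`, no `instance`, no notation, no named-fact hypothesis, no `sorry`; default heartbeats); lane `--supports stmt-HodgeConjecture-24833 --as helper` (count-neutral).
Currency of ★ K1₃ `K2E1TruncatedKernelDecayU3` ∕ ★ `K2E1TruncatedZeroMeanU3` §1: `G = U(2,1)(𝔸_{L⁺}) = (quasiSplit F E c 3).Adelic` (generic `(F, E, c)`), Haar `ν` on `G`, the unipotent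
radical `N(𝔸) = adelicUnipotent F E c 3` with a Haar measure `νN` and a set `𝓕 ⊆ N(𝔸)` of compact closure (a fundamental domain of `N(F)`), the Borel constant term ★
`borelConstantTerm νN 𝓕 φ g = νN(𝓕)⁻¹ • ∫_{u ∈ 𝓕} φ(u·g) dνN`, the RIGHT SMOOTHING `(R(η)φ)(p) = ∫ η(y)·φ(p·y) dν(y)` (★ `continuous_integral_mul_apply`, ★ `integral_mul_apply_rational_mul`).

THE MATHEMATICS [MoeglinWaldspurger1995, I.2.6; BernsteinLapid2019, §4 Claim 5; Garrett2018, Thm. 7.3.10].  ★ K1₃ `exists_bound_integral_mul_apply_of_domains` takes a LOCALLY INTEGRABLE,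
left-`N(F)`-invariant `φ` whose constant term vanishes ALMOST EVERYWHERE on `{H > H₀}`.  The `L²` edition (part 2, `K2E1TruncatedCuspDecayL2U3`) feeds it `φ := R(η)F` for a locally
square-integrable `F`; this part supplies the one genuinely new fact: the a.e. hypothesis TRANSFERS to the smoothing.  (§1) FUBINI on `𝓕 × G`: for `η ∈ C_c(G)`, `φ` measurable and locally
integrable, `νN(𝓕) < ∞`, `closure 𝓕` compact: `(R(η)φ)_B(g) = ∫ η(y)·φ_B(g·y) dν(y)` for EVERY `g` (the integrand `η(y)φ(ugy)` is integrable on `𝓕 × G`: each `u`-section is `η·(φ ∘ ℓ_{ug})`,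
integrable; `∫_y |η(y)φ(ugy)| ≤ ‖η‖_∞ ∫_{closure(𝓕)·g·supp η} |φ|` uniformly in `u ∈ 𝓕`).  (§2) NULL SETS MOVE: if `φ_B(h) = 0` for `ν`-a.e. `h` with `H(h) > H₀`, then for EVERY `g`,
`φ_B(g·y) = 0` for `ν`-a.e. `y` with `H(g·y) > H₀` (`y ↦ g·y` preserves `ν`).  (§3) HEIGHTS ON COMPACTS (★ P3-A): `H(g) ≤ κ·H(g·y)` for `y ∈ supp η`; hence for EVERY `g` with `H(g) > κ·H₀`
all `g·y`, `y ∈ supp η`, are high, the integrand of §1 vanishes a.e., and **`(R(η)φ)_B(g) = 0`** — pointwise, so a fortiori almost everywhere: the constant-term letter of ★ K1₃ for `R(η)φ`.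
* §1 `integrable_smoothingKernel_section`, `norm_integral_smoothingKernel_section_le`, `integrable_smoothingKernel_prod`, **`borelConstantTerm_smoothing_eq`**;
  §2 `ae_borelConstantTerm_mul_eq_zero`; §3 `lt_borelHeight_mul_of_mem_tsupport`, **`borelConstantTerm_smoothing_eq_zero_of_lt`**, **`exists_ae_borelConstantTerm_smoothing_eq_zero`**
  (the ★ K1₃ constant-term letter for `R(η)φ`, with `κ ≥ 1` from ★ P3-A; no sign condition on `H₀`).
HONEST LABEL: HC_CM is proved only modulo the 7 printed citations (2 remaining named inputs: hLiu418 = `stmt-HodgeConjecture-24832`, h413 = `stmt-HodgeConjecture-24833`)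
until rung 0 closes; this file asserts no named fact, closes no socket and crosses no ceiling by itself; count-neutral.
References: [MoeglinWaldspurger1995] I.2.6 · [BernsteinLapid2019] arXiv:1911.02342 §4 Claim 5 · [Garrett2018] Thm. 7.3.10 · [Rogawski1990] §2.1.
-/

set_option autoImplicit false
-- the mandated namespace repeats `HodgeConjecture.HodgeConjecture`, as in every `Theorems/*.lean` of this sub-problem
set_option linter.dupNamespace false

noncomputable section

open NumberField IsDedekindDomain MeasureTheory Measure Filter Topology Set
open scoped NNReal Pointwise ENNReal

namespace Summit.HodgeConjecture.HodgeConjecture.Cruxes.H413.K2E1TruncatedSmoothingConstantTermU3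

open Literature.NumberTheory.Automorphic Literature.NumberTheory.Automorphic.UnitaryGroup AdelicGroupData
open Summit.HodgeConjecture.HodgeConjecture.Cruxes.H413.K2E1TruncatedZeroMeanU3
open Summit.HodgeConjecture.HodgeConjecture.Cruxes.H413.K2E1TruncatedKernelDecayU3 (locallyIntegrable_comp_mul_left)
open Summit.HodgeConjecture.HodgeConjecture.Cruxes.H413.K2E1BLHeckeOperatorWeightedU2 (exists_borelHeight_mul_le_of_isCompact)

variable {F E : Type} [Field F] [NumberField F] [Field E] [NumberField E] [Algebra F E] {c : E ≃ₐ[F] E}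
  [MeasurableSpace (quasiSplit F E c 3).Adelic] [BorelSpace (quasiSplit F E c 3).Adelic]
  (ν : Measure (quasiSplit F E c 3).Adelic) [ν.IsHaarMeasure]
  [MeasurableSpace (adelicUnipotent F E c 3)] [BorelSpace (adelicUnipotent F E c 3)]
  (νN : Measure (adelicUnipotent F E c 3))

/-! ## §1 Fubini: the constant term of the smoothing -/

omit [MeasurableSpace (adelicUnipotent F E c 3)] [BorelSpace (adelicUnipotent F E c 3)] in
/-- Each `u`-section `y ↦ η(y)·φ(u·g·y)` of the smoothing kernel is `ν`-integrable (`φ ∘ ℓ_{ug}` locally integrable ★, `η` continuous of compact support). [folklore] -/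
theorem integrable_smoothingKernel_section {η : (quasiSplit F E c 3).Adelic → ℂ} (hη : Continuous η) (hηs : HasCompactSupport η)
    {φ : (quasiSplit F E c 3).Adelic → ℂ} (hφ : LocallyIntegrable φ ν) (p : (quasiSplit F E c 3).Adelic) :
    Integrable (fun y => η y * φ (p * y)) ν := by
  haveI : T2Space (quasiSplit F E c 3).Adelic := inferInstanceAs (T2Space (adelic F E c 3 ((StdForm.antidiagonal 3).over E)))
  exact (locallyIntegrable_comp_mul_left ν hφ p).integrable_smul_left_of_hasCompactSupport hη hηs

omit [MeasurableSpace (adelicUnipotent F E c 3)] [BorelSpace (adelicUnipotent F E c 3)] in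
/-- The uniform bound of the `u`-sections: `∫ ‖η(y)·φ(p·y)‖ dν(y) ≤ M_η · ∫_{C·supp η} ‖φ‖ dν` for `p ∈ C` (substitute `z = p·y`; `η(p⁻¹z) ≠ 0 ⟹ z ∈ C·supp η`). [folklore] -/
theorem norm_integral_smoothingKernel_section_le {η : (quasiSplit F E c 3).Adelic → ℂ} {Mη : ℝ} (hMη : ∀ g, ‖η g‖ ≤ Mη)
    {φ : (quasiSplit F E c 3).Adelic → ℂ} (hφ : LocallyIntegrable φ ν) {C : Set (quasiSplit F E c 3).Adelic} (hC : IsCompact (C * tsupport η))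
    {p : (quasiSplit F E c 3).Adelic} (hp : p ∈ C) :
    ∫ y, ‖η y * φ (p * y)‖ ∂ν ≤ Mη * ∫ z in C * tsupport η, ‖φ z‖ ∂ν := by
  haveI : SecondCountableTopology (quasiSplit F E c 3).Adelic := inferInstanceAs (SecondCountableTopology (adelic F E c 3 ((StdForm.antidiagonal 3).over E)))
  haveI : LocallyCompactSpace (quasiSplit F E c 3).Adelic := inferInstanceAs (LocallyCompactSpace (adelic F E c 3 ((StdForm.antidiagonal 3).over E)))
  haveI : T2Space (quasiSplit F E c 3).Adelic := inferInstanceAs (T2Space (adelic F E c 3 ((StdForm.antidiagonal 3).over E)))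
  have hsub : ∫ y, ‖η y * φ (p * y)‖ ∂ν = ∫ z, ‖η (p⁻¹ * z) * φ z‖ ∂ν := by
    rw [← integral_mul_left_eq_self (fun y => ‖η y * φ (p * y)‖) p⁻¹]
    exact integral_congr_ae (Eventually.of_forall fun z => by simp only [mul_inv_cancel_left])
  rw [hsub, ← integral_indicator hC.measurableSet, ← integral_const_mul]
  have hint : Integrable (fun z => Mη * (C * tsupport η).indicator (fun z => ‖φ z‖) z) ν :=
    (IntegrableOn.integrable_indicator (hφ.integrableOn_isCompact hC).norm hC.measurableSet).const_mul Mη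
  refine integral_mono_of_nonneg (Eventually.of_forall fun z => norm_nonneg _) hint (Eventually.of_forall fun z => ?_)
  show ‖η (p⁻¹ * z) * φ z‖ ≤ Mη * (C * tsupport η).indicator (fun z => ‖φ z‖) z
  by_cases hz : z ∈ C * tsupport η
  · rw [indicator_of_mem hz, norm_mul]
    exact mul_le_mul_of_nonneg_right (hMη _) (norm_nonneg _)
  · have hη0 : η (p⁻¹ * z) = 0 := by
      refine image_eq_zero_of_notMem_tsupport fun h => hz ?_
      exact ⟨p, hp, p⁻¹ * z, h, by simp only [mul_inv_cancel_left]⟩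
    rw [indicator_of_notMem hz, hη0, zero_mul, norm_zero, mul_zero]

/-- **THE SMOOTHING KERNEL IS INTEGRABLE ON `𝓕 × G`** (`η ∈ C_c(G)`, `φ` measurable and locally integrable, `νN(𝓕) < ∞`, `closure 𝓕` compact):
`(u, y) ↦ η(y)·φ(u·g·y) ∈ L¹(νN|_𝓕 ⊗ ν)` (sections §1, uniform bound §1 on the finite measure `νN|_𝓕`). [cite: MoeglinWaldspurger1995, I.2.6] -/
theorem integrable_smoothingKernel_prod [SFinite νN] {𝓕 : Set (adelicUnipotent F E c 3)} (h𝓕m : NullMeasurableSet 𝓕 νN) (h𝓕c : IsCompact (closure 𝓕)) (hν𝓕 : νN 𝓕 ≠ ∞)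
    {η : (quasiSplit F E c 3).Adelic → ℂ} (hη : Continuous η) (hηs : HasCompactSupport η)
    {φ : (quasiSplit F E c 3).Adelic → ℂ} (hφm : Measurable φ) (hφ : LocallyIntegrable φ ν) (g : (quasiSplit F E c 3).Adelic) :
    Integrable (fun q : adelicUnipotent F E c 3 × (quasiSplit F E c 3).Adelic => η q.2 * φ (((q.1 : adelicUnipotent F E c 3) : (quasiSplit F E c 3).Adelic) * g * q.2))
      ((νN.restrict 𝓕).prod ν) := by
  haveI : SecondCountableTopology (quasiSplit F E c 3).Adelic := inferInstanceAs (SecondCountableTopology (adelic F E c 3 ((StdForm.antidiagonal 3).over E)))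
  haveI : LocallyCompactSpace (quasiSplit F E c 3).Adelic := inferInstanceAs (LocallyCompactSpace (adelic F E c 3 ((StdForm.antidiagonal 3).over E)))
  haveI : T2Space (quasiSplit F E c 3).Adelic := inferInstanceAs (T2Space (adelic F E c 3 ((StdForm.antidiagonal 3).over E)))
  haveI : IsFiniteMeasure (νN.restrict 𝓕) := isFiniteMeasure_restrict.2 hν𝓕
  -- measurability of the kernel
  have hmul : Measurable fun q : adelicUnipotent F E c 3 × (quasiSplit F E c 3).Adelic => ((q.1 : adelicUnipotent F E c 3) : (quasiSplit F E c 3).Adelic) * g * q.2 :=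
    (((continuous_subtype_val.comp continuous_fst).mul continuous_const).mul continuous_snd).measurable
  have hmeas : AEStronglyMeasurable (fun q : adelicUnipotent F E c 3 × (quasiSplit F E c 3).Adelic =>
      η q.2 * φ (((q.1 : adelicUnipotent F E c 3) : (quasiSplit F E c 3).Adelic) * g * q.2)) ((νN.restrict 𝓕).prod ν) :=
    ((hη.measurable.comp measurable_snd).mul (hφm.comp hmul)).aestronglyMeasurable
  refine (integrable_prod_iff hmeas).2 ⟨Eventually.of_forall fun u =>
    integrable_smoothingKernel_section ν hη hηs hφ (((u : adelicUnipotent F E c 3) : (quasiSplit F E c 3).Adelic) * g), ?_⟩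
  -- the uniform bound on `𝓕`
  obtain ⟨Mη, hMη⟩ := hη.norm.bddAbove_range_of_hasCompactSupport hηs.norm
  have hMη' : ∀ x, ‖η x‖ ≤ Mη := fun x => hMη ⟨x, rfl⟩
  have hCc : IsCompact ((((↑) : adelicUnipotent F E c 3 → (quasiSplit F E c 3).Adelic) '' closure 𝓕 * {g}) * tsupport η) :=
    ((h𝓕c.image continuous_subtype_val).mul isCompact_singleton).mul hηs
  refine Integrable.mono' (integrable_const (Mη * ∫ z in (((↑) : adelicUnipotent F E c 3 → (quasiSplit F E c 3).Adelic) '' closure 𝓕 * {g}) * tsupport η, ‖φ z‖ ∂ν))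
    hmeas.norm.integral_prod_right' ((ae_restrict_mem₀ h𝓕m).mono fun u hu => ?_)
  have hmem : ((u : adelicUnipotent F E c 3) : (quasiSplit F E c 3).Adelic) * g ∈
      ((↑) : adelicUnipotent F E c 3 → (quasiSplit F E c 3).Adelic) '' closure 𝓕 * {g} :=
    Set.mul_mem_mul (mem_image_of_mem _ (subset_closure hu)) (mem_singleton g)
  have key := norm_integral_smoothingKernel_section_le ν hMη' hφ hCc hmem
  have hnn : 0 ≤ ∫ y, ‖η y * φ (((u : adelicUnipotent F E c 3) : (quasiSplit F E c 3).Adelic) * g * y)‖ ∂ν := integral_nonneg fun _ => norm_nonneg _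
  show ‖∫ y, ‖η y * φ (((u : adelicUnipotent F E c 3) : (quasiSplit F E c 3).Adelic) * g * y)‖ ∂ν‖ ≤ _
  rw [Real.norm_of_nonneg hnn]
  exact key

/-- **THE CONSTANT TERM OF THE SMOOTHING**: `(R(η)φ)_B(g) = ∫ η(y)·φ_B(g·y) dν(y)` for EVERY `g` — Fubini on `𝓕 × G` (§1 `integrable_smoothingKernel_prod`), then `u·g·y = u·(g·y)`
and the scalar `νN(𝓕)⁻¹` moves through. [cite: MoeglinWaldspurger1995, I.2.6] [cite: BernsteinLapid2019, §4 Claim 5 (p. 10)] -/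
theorem borelConstantTerm_smoothing_eq [SFinite νN] {𝓕 : Set (adelicUnipotent F E c 3)} (h𝓕m : NullMeasurableSet 𝓕 νN) (h𝓕c : IsCompact (closure 𝓕)) (hν𝓕 : νN 𝓕 ≠ ∞)
    {η : (quasiSplit F E c 3).Adelic → ℂ} (hη : Continuous η) (hηs : HasCompactSupport η)
    {φ : (quasiSplit F E c 3).Adelic → ℂ} (hφm : Measurable φ) (hφ : LocallyIntegrable φ ν) (g : (quasiSplit F E c 3).Adelic) :
    borelConstantTerm νN 𝓕 (fun p => ∫ y, η y * φ (p * y) ∂ν) g = ∫ y, η y * borelConstantTerm νN 𝓕 φ (g * y) ∂ν := by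
  haveI : SecondCountableTopology (quasiSplit F E c 3).Adelic := inferInstanceAs (SecondCountableTopology (adelic F E c 3 ((StdForm.antidiagonal 3).over E)))
  haveI : LocallyCompactSpace (quasiSplit F E c 3).Adelic := inferInstanceAs (LocallyCompactSpace (adelic F E c 3 ((StdForm.antidiagonal 3).over E)))
  haveI : T2Space (quasiSplit F E c 3).Adelic := inferInstanceAs (T2Space (adelic F E c 3 ((StdForm.antidiagonal 3).over E)))
  simp only [borelConstantTerm]
  rw [integral_integral_swap (integrable_smoothingKernel_prod ν νN h𝓕m h𝓕c hν𝓕 hη hηs hφm hφ g), ← integral_smul]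
  refine integral_congr_ae (Eventually.of_forall fun y => ?_)
  simp only [mul_assoc, integral_const_mul, Complex.real_smul]
  ring

/-! ## §2 Null sets move under left translation -/

omit [ν.IsHaarMeasure] [BorelSpace (adelicUnipotent F E c 3)] in
/-- If `φ_B(h) = 0` for `ν`-a.e. `h` with `H(h) > H₀`, then for EVERY `g`, `φ_B(g·y) = 0` for `ν`-a.e. `y` with `H(g·y) > H₀` (`y ↦ g·y` preserves the left Haar measure `ν`).
[folklore] -/
theorem ae_borelConstantTerm_mul_eq_zero [ν.IsMulLeftInvariant] {𝓕 : Set (adelicUnipotent F E c 3)} {φ : (quasiSplit F E c 3).Adelic → ℂ} {H₀ : ℝ}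
    (hφ0 : ∀ᵐ h ∂ν, H₀ < (borelHeight h : ℝ) → borelConstantTerm νN 𝓕 φ h = 0) (g : (quasiSplit F E c 3).Adelic) :
    ∀ᵐ y ∂ν, H₀ < (borelHeight (g * y) : ℝ) → borelConstantTerm νN 𝓕 φ (g * y) = 0 :=
  (measurePreserving_mul_left ν g).quasiMeasurePreserving.ae hφ0

/-! ## §3 Heights on compacts: the constant term of the smoothing vanishes above `κ·H₀` -/

omit [MeasurableSpace (quasiSplit F E c 3).Adelic] [BorelSpace (quasiSplit F E c 3).Adelic] [MeasurableSpace (adelicUnipotent F E c 3)] [BorelSpace (adelicUnipotent F E c 3)] in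
/-- Height transfer along the support: if `H(x) ≤ κ·H(x·y)` for `y ∈ supp η` (★ P3-A `exists_borelHeight_mul_le_of_isCompact`) and `H(g) > κ·H₀`, then `H(g·y) > H₀` for every
`y ∈ supp η` (no sign condition on `H₀`: `κ·H(gy) ≤ κ·H₀ < H(g) ≤ κ·H(gy)` is absurd). [folklore] -/
theorem lt_borelHeight_mul_of_mem_tsupport {η : (quasiSplit F E c 3).Adelic → ℂ} {κ : ℝ≥0}
    (hκ : ∀ x : (quasiSplit F E c 3).Adelic, ∀ y ∈ tsupport η, borelHeight x ≤ κ * borelHeight (x * y))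
    {H₀ : ℝ} {g : (quasiSplit F E c 3).Adelic} (hg : (κ : ℝ) * H₀ < (borelHeight g : ℝ))
    {y : (quasiSplit F E c 3).Adelic} (hy : y ∈ tsupport η) : H₀ < (borelHeight (g * y) : ℝ) := by
  have h1 : ((borelHeight g : ℝ≥0) : ℝ) ≤ (κ : ℝ) * (borelHeight (g * y) : ℝ) := by exact_mod_cast hκ g y hy
  have hκ0 : (0 : ℝ) ≤ κ := κ.coe_nonneg
  by_contra hle
  rw [not_lt] at hle
  have h2 : (κ : ℝ) * (borelHeight (g * y) : ℝ) ≤ (κ : ℝ) * H₀ := mul_le_mul_of_nonneg_left hle hκ0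
  linarith

/-- **THE CONSTANT TERM OF THE SMOOTHING VANISHES ABOVE `κ·H₀`** — POINTWISE, for EVERY `g` with `H(g) > κ·H₀`: `(R(η)φ)_B(g) = 0`, granted `φ_B = 0` a.e. on `{H > H₀}` (any real `H₀`),
`η ∈ C_c(G)` with `H(x) ≤ κ·H(x·y)` on `supp η` (★ P3-A), `φ` measurable and locally integrable (§1 + §2 + the height transfer: the integrand `η(y)·φ_B(g·y)` vanishes a.e.).
[cite: MoeglinWaldspurger1995, I.2.6–I.2.7] [cite: BernsteinLapid2019, §4 Claim 5 (p. 10)] -/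
theorem borelConstantTerm_smoothing_eq_zero_of_lt [SFinite νN] {𝓕 : Set (adelicUnipotent F E c 3)} (h𝓕m : NullMeasurableSet 𝓕 νN) (h𝓕c : IsCompact (closure 𝓕))
    (hν𝓕 : νN 𝓕 ≠ ∞) {η : (quasiSplit F E c 3).Adelic → ℂ} (hη : Continuous η) (hηs : HasCompactSupport η)
    {φ : (quasiSplit F E c 3).Adelic → ℂ} (hφm : Measurable φ) (hφ : LocallyIntegrable φ ν)
    {H₀ : ℝ} (hφ0 : ∀ᵐ h ∂ν, H₀ < (borelHeight h : ℝ) → borelConstantTerm νN 𝓕 φ h = 0)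
    {κ : ℝ≥0} (hκ : ∀ x : (quasiSplit F E c 3).Adelic, ∀ y ∈ tsupport η, borelHeight x ≤ κ * borelHeight (x * y))
    {g : (quasiSplit F E c 3).Adelic} (hg : (κ : ℝ) * H₀ < (borelHeight g : ℝ)) :
    borelConstantTerm νN 𝓕 (fun p => ∫ y, η y * φ (p * y) ∂ν) g = 0 := by
  rw [borelConstantTerm_smoothing_eq ν νN h𝓕m h𝓕c hν𝓕 hη hηs hφm hφ g]
  refine integral_eq_zero_of_ae ((ae_borelConstantTerm_mul_eq_zero ν νN hφ0 g).mono fun y hy => ?_)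
  by_cases hyη : y ∈ tsupport η
  · simp only [hy (lt_borelHeight_mul_of_mem_tsupport hκ hg hyη), mul_zero, Pi.zero_apply]
  · simp only [image_eq_zero_of_notMem_tsupport hyη, zero_mul, Pi.zero_apply]

/-- **THE ★ K1₃ LETTER FOR `R(η)φ`** (a.e. form of §3, with the compact-support constant produced): for `η ∈ C_c(G)` and `φ` measurable, locally integrable with `φ_B = 0` a.e. on
`{H > H₀}` (any real `H₀`), there is `κ ≥ 1` (★ P3-A on `supp η`) with `(R(η)φ)_B(g) = 0` for EVERY — hence `ν`-a.e. — `g` with `H(g) > κ·H₀`. [cite: MoeglinWaldspurger1995, I.2.6–I.2.7] -/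
theorem exists_ae_borelConstantTerm_smoothing_eq_zero [SFinite νN] {𝓕 : Set (adelicUnipotent F E c 3)} (h𝓕m : NullMeasurableSet 𝓕 νN) (h𝓕c : IsCompact (closure 𝓕))
    (hν𝓕 : νN 𝓕 ≠ ∞) {η : (quasiSplit F E c 3).Adelic → ℂ} (hη : Continuous η) (hηs : HasCompactSupport η)
    {φ : (quasiSplit F E c 3).Adelic → ℂ} (hφm : Measurable φ) (hφ : LocallyIntegrable φ ν)
    {H₀ : ℝ} (hφ0 : ∀ᵐ h ∂ν, H₀ < (borelHeight h : ℝ) → borelConstantTerm νN 𝓕 φ h = 0) :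
    ∃ κ : ℝ≥0, 1 ≤ κ ∧ (∀ g : (quasiSplit F E c 3).Adelic, (κ : ℝ) * H₀ < (borelHeight g : ℝ) → borelConstantTerm νN 𝓕 (fun p => ∫ y, η y * φ (p * y) ∂ν) g = 0) ∧
      ∀ᵐ g ∂ν, (κ : ℝ) * H₀ < (borelHeight g : ℝ) → borelConstantTerm νN 𝓕 (fun p => ∫ y, η y * φ (p * y) ∂ν) g = 0 := by
  obtain ⟨κ, hκ1, hκ⟩ := exists_borelHeight_mul_le_of_isCompact (F := F) (E := E) (c := c) (N := 3) hηs
  have hpt : ∀ g : (quasiSplit F E c 3).Adelic, (κ : ℝ) * H₀ < (borelHeight g : ℝ) →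
      borelConstantTerm νN 𝓕 (fun p => ∫ y, η y * φ (p * y) ∂ν) g = 0 := fun g hg =>
    borelConstantTerm_smoothing_eq_zero_of_lt ν νN h𝓕m h𝓕c hν𝓕 hη hηs hφm hφ hφ0 (fun x y hy => (hκ x y hy).2) hg
  exact ⟨κ, hκ1, hpt, Eventually.of_forall hpt⟩

end Summit.HodgeConjecture.HodgeConjecture.Cruxes.H413.K2E1TruncatedSmoothingConstantTermU3

end
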